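import Summits.QuantumFields.BalabanUV.T4Continuum.Support.VariationalVectorEndOfLeaves

/-!
# T⁴ programme, spine node NE2 (U1a), lane P2 — THE SUPPLIERS' SMALL PARAMETERS MEET THE VECTOR END's DECAY HYPOTHESES UNDER THE
# PLAQUETTE-TYPE CLASS (the `VariationalCovariantEnd.level_defects_le` twin for the vector sector; model level; cell `pub-balaban`)

NE2 formalisation swarm `b2b-balaban-t4-ne2-formalise-*`, leaf prover 10 GEN 3 (`prover-b2b-balaban-t4-ne2-formalise-leaf-10-g3-0`, lineage V-COMP TOWER ∕
V-END); journal INTENT CLAIMS.log 2026-08-20 14:40Z.  On top of `VariationalVectorEndOfLeaves.towerLimitRate_effV_of_leaves` (p220074) — BY NAME; real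
arithmetic only, nothing defined.

THE POINT.  p220074 asks the three small leaf parameters to DECAY geometrically, `δ k ≤ c_δ·θ^k`, `ε₁ k ≤ c_ε·θ^k`, `δ′ k ≤ c_δ′·θ^k`.  The suppliers landed
them as explicit functions of the level `n = L^k` and of per-level defect data:
 * V-ONE-1F (`VariationalVectorOneStepPhys.blockSpin_Q1_le`, p219670): `ε₁ = 4(d+26)·L∕n²`, `δ′ = n·L·√(d(50p²∕L + (32(1+d²)+400)m²)∕2)` (operator
   plaquette defect `p`, the two frame defects `m`);
 * V-FED (`VariationalVectorFederbushPhys.ScV_QvL_le_curl`, p217269): `δ = d·n·(2m_F + 2L·w′)` (line mismatch `m_F`, comb defect `w′`).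
Under the PLAQUETTE-TYPE CLASS — every defect is plaquette-sized in physical units: `n²·p ≤ c_p`, `n²·m ≤ c_m`, `n²·m_F ≤ c_F`, `n²·w′ ≤ c_w′` (k-uniform
constants; this is what the taxi ∕ frame dictionary produces: `m, m₁ ∝ (L²−1)a′`, `w′ ∝ L²a′`, `(nL)²a′ ≤ c`) — §1 proves, at `n = L^k`, `θ = L⁻¹`, `1 ≤ L`:
  `ε₁ ≤ 4(d+26)L·θ^k` (`eps1V_level_le`), `δ′ ≤ L·√(d(50c_p²∕L + (32(1+d²)+400)c_m²)∕2)·θ^k` (`deltaPV_level_le`), `δ ≤ 2d(c_F + L·c_w′)·θ^k` (`deltaFV_level_le`),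
and §2 **`towerLimitRate_effV_of_leaves_class`** = p220074's END with the three decay binders REPLACED by the four class lines and the suppliers' formulas
substituted into `hFED` ∕ `hONE` (`θ := L⁻¹`, `2 ≤ L`).  The GAUGE-FUNCTIONAL parts of the two Federbush-type parameters — `δ_G` in V-FED's full binder
(p217269 `ScV_QvL_le`: `δ = δ_curl + δ_G`) and the fine-slice ∕ (GF2′) part of V-ONE's `δ′` (p219670 `…_of_GF`: `δ′ + δ_G`; p221158 `…_of_slice`:
`δ′ + √(σ′(4(1+d²)+50))`) — have NO formula yet (leaf V-GF OPEN): they enter as displayed nonnegative sequences `dG k`, `sG k` with their OWN decay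
`≤ c·θ^k`, added to the class-controlled curl parts.  So the only per-level data left displayed are the five leaf inequalities, uniform `Λ`∕`C_P`∕`C_R`, the class,
and the two gauge-part decays.  NOT HERE: the frame-reference bookkeeping of the composite carriers.

HONEST FRAMING (T4-DAG p. 1).  Real arithmetic + plumbing; nothing printed is a hypothesis; no `def`, no `def … : Prop`, no `sorry`; axioms standard.  No leaf is
discharged; V-END NOT proved; NE2 NOT proved; spine PROVED 0∕9 unchanged; rung (B)+1 finite T⁴ — NOT infinite volume, NOT mass gap, NOT Clay.  HONEST DEPENDENCY
(cell, verbatim): continuum YM on T⁴ ⇐ BetaPertH ∧ nine spine estimates (0/9 proved); BetaPertH ⇐ (D1) ∧ (D4) ∧ CAP+tail; G-an2-4 gates asym, D1 and NE2/3/4.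
-/

noncomputable section

namespace Summit.QuantumFields.BalabanUV.T4Continuum.VariationalVectorEndOfLeaves

open Finset
open scoped Matrix ComplexConjugate ComplexOrder Matrix.Norms.L2Operator BigOperators
open Literature.MathematicalPhysics.QuantumFieldTheory.Balaban1983to89.B5Prop11Plancherel (Tor fine unitVec)
open Literature.Analysis.Complex (qform)
open Summit.QuantumFields.BalabanUV.T4Continuum.VariationalTransfer (blockSpin)
open Summit.QuantumFields.BalabanUV.T4Continuum.VariationalColourTower (Rtrv)
open Summit.QuantumFields.BalabanUV.T4Continuum.CovariantAveragingTower (TowerLimitRate)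
open Summit.QuantumFields.BalabanUV.T4Continuum.VectorBlockTrialForm (nsqV QvL compL)
open Summit.QuantumFields.BalabanUV.T4Continuum.VariationalVectorForm
open Summit.QuantumFields.BalabanUV.T4Continuum.VariationalVectorEffective (unc effV)
open Summit.QuantumFields.BalabanUV.T4Continuum.VariationalVectorTower (Gtr QmL)

variable {d : ℕ}

/-! ## §1 The three small parameters decay like `L^{−k}` under the plaquette-type class -/

section Decay

variable (L : ℕ)

/-- level facts: `n = L^k` as a real is `≥ 1` and `n⁻¹ = (L⁻¹)^k`, for `1 ≤ L`. [folklore] -/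
theorem levelV_facts (hL1 : (1 : ℝ) ≤ L) (k : ℕ) :
    (1 : ℝ) ≤ (((L ^ k : ℕ)) : ℝ) ∧ ((((L ^ k : ℕ)) : ℝ))⁻¹ = ((L : ℝ)⁻¹) ^ k ∧ (0 : ℝ) < (((L ^ k : ℕ)) : ℝ) := by
  have h1 : (1 : ℝ) ≤ (((L ^ k : ℕ)) : ℝ) := by push_cast; exact one_le_pow₀ hL1
  exact ⟨h1, by push_cast; rw [inv_pow], by linarith⟩

/-- **V-ONE-1F's `ε₁` DECAYS**: `4(d+26)·L∕n² ≤ 4(d+26)L·(L⁻¹)^k` at `n = L^k` (`n⁻² ≤ n⁻¹`). [folklore] -/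
theorem eps1V_level_le (hL1 : (1 : ℝ) ≤ L) (k : ℕ) :
    4 * ((d : ℝ) + 26) * ((L : ℝ) / (((L ^ k : ℕ)) : ℝ) ^ 2) ≤ 4 * ((d : ℝ) + 26) * L * ((L : ℝ)⁻¹) ^ k := by
  obtain ⟨hn1, hninv, hn0⟩ := levelV_facts L hL1 k
  set n : ℝ := (((L ^ k : ℕ)) : ℝ)
  rw [← hninv]
  have hL0 : (0 : ℝ) ≤ L := by linarith
  have key : (L : ℝ) / n ^ 2 ≤ L * n⁻¹ := by
    rw [div_eq_mul_inv]
    refine mul_le_mul_of_nonneg_left ?_ hL0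
    rw [← inv_pow]
    calc n⁻¹ ^ 2 = n⁻¹ * n⁻¹ := sq _
      _ ≤ n⁻¹ * 1 := mul_le_mul_of_nonneg_left (inv_le_one_of_one_le₀ hn1) (inv_nonneg.mpr hn0.le)
      _ = n⁻¹ := mul_one _
  have h26 : (0 : ℝ) ≤ 4 * ((d : ℝ) + 26) := by positivity
  calc 4 * ((d : ℝ) + 26) * ((L : ℝ) / n ^ 2) ≤ 4 * ((d : ℝ) + 26) * (L * n⁻¹) := mul_le_mul_of_nonneg_left key h26
    _ = _ := by ring

/-- **V-ONE-1F's `δ′` DECAYS**: with `n²p ≤ c_p`, `n²m ≤ c_m` (`p, m ≥ 0`),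
`n·L·√(d(50p²∕L + C·m²)∕2) ≤ L·√(d(50c_p²∕L + C·c_m²)∕2)·(L⁻¹)^k` at `n = L^k`, `C = 32(1+d²)+400`. [folklore] -/
theorem deltaPV_level_le (hL1 : (1 : ℝ) ≤ L) (k : ℕ) {p m cp cm : ℝ} (hp : 0 ≤ p) (hm : 0 ≤ m)
    (hpc : (((L ^ k : ℕ)) : ℝ) ^ 2 * p ≤ cp) (hmc : (((L ^ k : ℕ)) : ℝ) ^ 2 * m ≤ cm) :
    (((L ^ k : ℕ)) : ℝ) * L * Real.sqrt (d * (50 * p ^ 2 / L + (32 * (1 + (d : ℝ) ^ 2) + 400) * m ^ 2) / 2)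
      ≤ L * Real.sqrt (d * (50 * cp ^ 2 / L + (32 * (1 + (d : ℝ) ^ 2) + 400) * cm ^ 2) / 2) * ((L : ℝ)⁻¹) ^ k := by
  obtain ⟨hn1, hninv, hn0⟩ := levelV_facts L hL1 k
  set n : ℝ := (((L ^ k : ℕ)) : ℝ)
  rw [← hninv]
  have hL0 : (0 : ℝ) < L := by linarith
  have hn2 : (0 : ℝ) < n ^ 2 := by positivity
  -- the defect data in terms of the class constants
  have hp' : p ≤ cp * (n ^ 2)⁻¹ := by rw [← div_eq_mul_inv, le_div_iff₀ hn2, mul_comm]; exact hpc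
  have hm' : m ≤ cm * (n ^ 2)⁻¹ := by rw [← div_eq_mul_inv, le_div_iff₀ hn2, mul_comm]; exact hmc
  have hcp : 0 ≤ cp := le_trans (by positivity) hpc
  have hcm : 0 ≤ cm := le_trans (by positivity) hmc
  have hp2 : p ^ 2 ≤ (cp * (n ^ 2)⁻¹) ^ 2 := pow_le_pow_left₀ hp hp' 2
  have hm2 : m ^ 2 ≤ (cm * (n ^ 2)⁻¹) ^ 2 := pow_le_pow_left₀ hm hm' 2
  set X : ℝ := d * (50 * cp ^ 2 / L + (32 * (1 + (d : ℝ) ^ 2) + 400) * cm ^ 2) / 2 with hX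
  have hX0 : 0 ≤ X := by positivity
  have hin : d * (50 * p ^ 2 / L + (32 * (1 + (d : ℝ) ^ 2) + 400) * m ^ 2) / 2 ≤ ((n ^ 2)⁻¹) ^ 2 * X := by
    have h50 : 50 * p ^ 2 / L ≤ 50 * (cp * (n ^ 2)⁻¹) ^ 2 / L :=
      div_le_div_of_nonneg_right (mul_le_mul_of_nonneg_left hp2 (by norm_num)) hL0.le
    have hC : (32 * (1 + (d : ℝ) ^ 2) + 400) * m ^ 2 ≤ (32 * (1 + (d : ℝ) ^ 2) + 400) * (cm * (n ^ 2)⁻¹) ^ 2 :=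
      mul_le_mul_of_nonneg_left hm2 (by positivity)
    have hd : (0 : ℝ) ≤ d := Nat.cast_nonneg d
    have e : ((n ^ 2)⁻¹) ^ 2 * X = d * (50 * (cp * (n ^ 2)⁻¹) ^ 2 / L + (32 * (1 + (d : ℝ) ^ 2) + 400) * (cm * (n ^ 2)⁻¹) ^ 2) / 2 := by
      rw [hX]; ring
    rw [e]
    have := add_le_add h50 hC
    nlinarith
  have hsq : Real.sqrt (d * (50 * p ^ 2 / L + (32 * (1 + (d : ℝ) ^ 2) + 400) * m ^ 2) / 2) ≤ (n ^ 2)⁻¹ * Real.sqrt X := by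
    refine (Real.sqrt_le_sqrt hin).trans (le_of_eq ?_)
    rw [Real.sqrt_mul (sq_nonneg _), Real.sqrt_sq (by positivity)]
  have hnn : n * (n ^ 2)⁻¹ = n⁻¹ := by
    field_simp
  calc n * L * Real.sqrt (d * (50 * p ^ 2 / L + (32 * (1 + (d : ℝ) ^ 2) + 400) * m ^ 2) / 2)
      ≤ n * L * ((n ^ 2)⁻¹ * Real.sqrt X) := mul_le_mul_of_nonneg_left hsq (by positivity)
    _ = L * Real.sqrt X * (n * (n ^ 2)⁻¹) := by ring
    _ = L * Real.sqrt X * n⁻¹ := by rw [hnn]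

/-- **V-FED's `δ` DECAYS**: with `n²m_F ≤ c_F`, `n²w′ ≤ c_w′`, `d·n·(2m_F + 2L·w′) ≤ 2d(c_F + L·c_w′)·(L⁻¹)^k` at `n = L^k`. [folklore] -/
theorem deltaFV_level_le (hL1 : (1 : ℝ) ≤ L) (k : ℕ) {mF w' cF cw : ℝ}
    (hmFc : (((L ^ k : ℕ)) : ℝ) ^ 2 * mF ≤ cF) (hwc : (((L ^ k : ℕ)) : ℝ) ^ 2 * w' ≤ cw) :
    (d : ℝ) * ((((L ^ k : ℕ)) : ℝ) * (2 * mF + 2 * L * w')) ≤ 2 * d * (cF + L * cw) * ((L : ℝ)⁻¹) ^ k := by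
  obtain ⟨hn1, hninv, hn0⟩ := levelV_facts L hL1 k
  set n : ℝ := (((L ^ k : ℕ)) : ℝ)
  rw [← hninv]
  have hL0 : (0 : ℝ) ≤ L := by linarith
  have hd : (0 : ℝ) ≤ d := Nat.cast_nonneg d
  -- `n·m_F ≤ c_F·n⁻¹`, `n·w′ ≤ c_w′·n⁻¹`
  have h1 : n * mF ≤ cF * n⁻¹ := by
    rw [← div_eq_mul_inv, le_div_iff₀ hn0]; nlinarith
  have h2 : n * w' ≤ cw * n⁻¹ := by
    rw [← div_eq_mul_inv, le_div_iff₀ hn0]; nlinarith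
  have e : (d : ℝ) * (n * (2 * mF + 2 * L * w')) = d * (2 * (n * mF) + 2 * L * (n * w')) := by ring
  rw [e]
  have h3 : 2 * (n * mF) + 2 * L * (n * w') ≤ 2 * (cF * n⁻¹) + 2 * L * (cw * n⁻¹) := by nlinarith
  calc (d : ℝ) * (2 * (n * mF) + 2 * L * (n * w')) ≤ d * (2 * (cF * n⁻¹) + 2 * L * (cw * n⁻¹)) := mul_le_mul_of_nonneg_left h3 hd
    _ = 2 * d * (cF + L * cw) * n⁻¹ := by ring

end Decay

/-! ## §2 The vector END modulo the leaves with the suppliers' parameters under the class -/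

section Tower

variable (L : ℕ) [NeZero L] (M : Fin d → ℕ) [hM : ∀ μ, NeZero (M μ)]
variable (R : (k : ℕ) → Tor (fine (L ^ k) M) → Fin d → (ℂ →L[ℂ] ℂ))
variable (R' : (k : ℕ) → Tor (fine L (fine (L ^ k) M)) → Fin d → (ℂ →L[ℂ] ℂ))
variable (Gm : (k : ℕ) → Matrix (Tor (fine (L ^ k) M) × Fin d) (Tor (fine (L ^ k) M) × Fin d) ℂ)
variable (G : (k : ℕ) → (Tor (fine (L ^ k) M) → Fin d → ℂ) → ℝ)
variable (G' : (k : ℕ) → (Tor (fine L (fine (L ^ k) M)) → Fin d → ℂ) → ℝ)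
variable (T : (k : ℕ) → Tor M → (Fin d → Fin (L ^ k)) → Fin (L ^ k) → Fin d → (ℂ →L[ℂ] ℂ))
variable (T' : (k : ℕ) → Tor (fine (L ^ k) M) → (Fin d → Fin L) → Fin L → Fin d → (ℂ →L[ℂ] ℂ))

/-- **THE VECTOR END OF ROAD P2 MODULO THE LEAVES, SUPPLIERS' PARAMETERS UNDER THE PLAQUETTE-TYPE CLASS.**  `towerLimitRate_effV_of_leaves` (p220074) with
`θ := L⁻¹` (`2 ≤ L`) and the three decay binders REPLACED by: per-level defect data `p k, m k` (V-ONE-1F's plaquette ∕ frame defects), `m_F k, w′ k`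
(V-FED's line mismatch ∕ comb defect), all `≥ 0`, the CLASS lines `n²·p ≤ c_p`, `n²·m ≤ c_m`, `n²·m_F ≤ c_F`, `n²·w′ ≤ c_w′` at `n = L^k`, the displayed
gauge parts `dG k`, `sG k ≥ 0` with `dG k ≤ c_dG·(L⁻¹)^k`, `sG k ≤ c_sG·(L⁻¹)^k` (leaf V-GF's, no formula yet), and the leaves `hFED` ∕ `hONE` displayed WITH THE
SUPPLIERS' PARAMETERS `δ = d·n·(2m_F + 2L·w′) + dG`, `ε₁ = 4(d+26)·L∕n²`, `δ′ = n·L·√(d(50p²∕L + (32(1+d²)+400)m²)∕2) + sG` (p217269 `ScV_QvL_le` ∕ p219670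
`…_of_GF` ∕ p221158 `…_of_slice`, at the tower's carriers).  Rate constant:
`eV Λ⋆ C_P⋆ (2d(c_F + L·c_w′) + c_dG) + ePV Λ⋆ C_P⋆ C_R⋆ (4(d+26)L) (L·√(d(50c_p²∕L + (32(1+d²)+400)c_m²)∕2) + c_sG)`. [folklore] -/
theorem towerLimitRate_effV_of_leaves_class (hL : 2 ≤ L) (hGm : ∀ k, (Gm k).PosSemidef) (hG : ∀ k W, G k W = qform (Gm k) (unc W))
    (hTcomp : ∀ k, T (k + 1) = compL (L ^ k) L M (T k) (T' k)) (hRtr : ∀ k, R (k + 1) = Rtrv (L ^ k) L M (R' k))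
    (hGtr : ∀ k, G (k + 1) = Gtr (L ^ k) L M (G' k))
    (hsurj₁ : ∀ k, Function.Surjective (QvL L (fine (L ^ k) M) (T' k)))
    {a : ℝ} (ha : 0 < a)
    (Λ CP CR p m mF w' dG sG : ℕ → ℝ) {Λs CPs CRs cp cm cF cw cdG csG : ℝ}
    (hΛ : ∀ k, 0 ≤ Λ k) (hΛs : ∀ k, Λ k ≤ Λs) (hCP : ∀ k, 0 ≤ CP k) (hCPs : ∀ k, CP k ≤ CPs) (hCR : ∀ k, 0 ≤ CR k) (hCRs : ∀ k, CR k ≤ CRs)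
    (hp : ∀ k, 0 ≤ p k) (hm : ∀ k, 0 ≤ m k) (hmF : ∀ k, 0 ≤ mF k) (hw' : ∀ k, 0 ≤ w' k)
    -- the plaquette-type CLASS
    (hpc : ∀ k, (((L ^ k : ℕ)) : ℝ) ^ 2 * p k ≤ cp) (hmc : ∀ k, (((L ^ k : ℕ)) : ℝ) ^ 2 * m k ≤ cm)
    (hmFc : ∀ k, (((L ^ k : ℕ)) : ℝ) ^ 2 * mF k ≤ cF) (hwc : ∀ k, (((L ^ k : ℕ)) : ℝ) ^ 2 * w' k ≤ cw)
    -- the gauge-functional parts of the two Federbush-type parameters (leaf V-GF, displayed) with their own decay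
    (hdG : ∀ k, 0 ≤ dG k) (hsG : ∀ k, 0 ≤ sG k) (hdGθ : ∀ k, dG k ≤ cdG * ((L : ℝ)⁻¹) ^ k) (hsGθ : ∀ k, sG k ≤ csG * ((L : ℝ)⁻¹) ^ k)
    {ρV : (k : ℕ) → (Tor (fine (L ^ k) M) → Fin d → ℂ) → ℝ} (hρ0 : ∀ k W, 0 ≤ ρV k W)
    (hUBc : ∀ k (φ : Tor M → Fin d → ℂ), ∃ W, QvL (L ^ k) M (T k) W = φ ∧ ScV (L ^ k) M (R k) (G k) W ≤ Λ k * nsqV M φ)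
    (hUBf : ∀ k (φ : Tor M → Fin d → ℂ), ∃ W', QvL (L ^ k) M (T k) (QvL L (fine (L ^ k) M) (T' k) W') = φ ∧
      SfV (L ^ k) L M (R' k) (G' k) W' ≤ Λ k * nsqV M φ)
    (hPc : ∀ k W, qWV (L ^ k) M W ≤ CP k * (ScV (L ^ k) M (R k) (G k) W + nsqV M (QvL (L ^ k) M (T k) W)))
    (hPf : ∀ k W', qVV (L ^ k) L M W' ≤ CP k * (SfV (L ^ k) L M (R' k) (G' k) W' + nsqV M (QvL (L ^ k) M (T k) (QvL L (fine (L ^ k) M) (T' k) W'))))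
    -- V-FED with its parameter `δ = d·n·(2m_F + 2L·w′) + δ_G`
    (hFED : ∀ k W', ScV (L ^ k) M (R k) (G k) (QvL L (fine (L ^ k) M) (T' k) W')
      ≤ (Real.sqrt (SfV (L ^ k) L M (R' k) (G' k) W')
          + ((d : ℝ) * ((((L ^ k : ℕ)) : ℝ) * (2 * mF k + 2 * L * w' k)) + dG k) * Real.sqrt (qVV (L ^ k) L M W')) ^ 2)
    -- V-ONE with its parameters `ε₁ = 4(d+26)L∕n²`, `δ′ = nL√(…) + s_G`
    (hONE : ∀ k W, blockSpin (QvL L (fine (L ^ k) M) (T' k)) (SfV (L ^ k) L M (R' k) (G' k)) W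
      ≤ (Real.sqrt (ScV (L ^ k) M (R k) (G k) W + 4 * ((d : ℝ) + 26) * ((L : ℝ) / (((L ^ k : ℕ)) : ℝ) ^ 2) * ρV k W)
          + ((((L ^ k : ℕ)) : ℝ) * L * Real.sqrt (d * (50 * p k ^ 2 / L + (32 * (1 + (d : ℝ) ^ 2) + 400) * m k ^ 2) / 2) + sG k)
            * Real.sqrt (qWV (L ^ k) M W)) ^ 2)
    (hREG : ∀ k (φ : Tor M → Fin d → ℂ) W, QvL (L ^ k) M (T k) W = φ →
      (∀ W₂, QvL (L ^ k) M (T k) W₂ = φ → ScV (L ^ k) M (R k) (G k) W ≤ ScV (L ^ k) M (R k) (G k) W₂) →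
      ρV k W ≤ CR k * (ScV (L ^ k) M (R k) (G k) W + nsqV M φ)) :
    TowerLimitRate (ι := fun _ => Tor M × Fin d) (fun _ => (1 : Matrix (Tor M × Fin d) (Tor M × Fin d) ℂ)) 1
      (fun k => effV (L ^ k) M (R k) (Gm k) (QmL (L ^ k) M (T k)) a)
      (eV Λs CPs (2 * d * (cF + L * cw) + cdG)
        + ePV Λs CPs CRs (4 * ((d : ℝ) + 26) * L) (L * Real.sqrt (d * (50 * cp ^ 2 / L + (32 * (1 + (d : ℝ) ^ 2) + 400) * cm ^ 2) / 2) + csG))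
      ((L : ℝ)⁻¹) := by
  have hL2 : (2 : ℝ) ≤ L := by exact_mod_cast hL
  have hL1 : (1 : ℝ) ≤ L := by linarith
  have hθ0 : (0 : ℝ) ≤ (L : ℝ)⁻¹ := by positivity
  have hθ1 : (L : ℝ)⁻¹ < 1 := inv_lt_one_of_one_lt₀ (by linarith)
  have hδ : ∀ k, (d : ℝ) * ((((L ^ k : ℕ)) : ℝ) * (2 * mF k + 2 * L * w' k)) + dG k
      ≤ (2 * d * (cF + L * cw) + cdG) * ((L : ℝ)⁻¹) ^ k := fun k => by
    have h1 := deltaFV_level_le (d := d) L hL1 k (hmFc k) (hwc k)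
    have h2 := hdGθ k
    linarith [add_mul (2 * d * (cF + L * cw)) cdG (((L : ℝ)⁻¹) ^ k)]
  have hδ' : ∀ k, (((L ^ k : ℕ)) : ℝ) * L * Real.sqrt (d * (50 * p k ^ 2 / L + (32 * (1 + (d : ℝ) ^ 2) + 400) * m k ^ 2) / 2) + sG k
      ≤ (L * Real.sqrt (d * (50 * cp ^ 2 / L + (32 * (1 + (d : ℝ) ^ 2) + 400) * cm ^ 2) / 2) + csG) * ((L : ℝ)⁻¹) ^ k := fun k => by
    have h1 := deltaPV_level_le (d := d) L hL1 k (hp k) (hm k) (hpc k) (hmc k)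
    have h2 := hsGθ k
    linarith [add_mul (L * Real.sqrt (d * (50 * cp ^ 2 / L + (32 * (1 + (d : ℝ) ^ 2) + 400) * cm ^ 2) / 2)) csG (((L : ℝ)⁻¹) ^ k)]
  refine towerLimitRate_effV_of_leaves L M R R' Gm G G' T T' hGm hG hTcomp hRtr hGtr hsurj₁ ha Λ CP CR
    (fun k => (d : ℝ) * ((((L ^ k : ℕ)) : ℝ) * (2 * mF k + 2 * L * w' k)) + dG k)
    (fun k => 4 * ((d : ℝ) + 26) * ((L : ℝ) / (((L ^ k : ℕ)) : ℝ) ^ 2))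
    (fun k => (((L ^ k : ℕ)) : ℝ) * L * Real.sqrt (d * (50 * p k ^ 2 / L + (32 * (1 + (d : ℝ) ^ 2) + 400) * m k ^ 2) / 2) + sG k)
    hΛ hΛs hCP hCPs hCR hCRs (fun k => by have := hmF k; have := hw' k; have := hdG k; positivity)
    (fun k => by positivity) (fun k => by have := hsG k; positivity)
    hθ0 hθ1 hδ (fun k => eps1V_level_le L hL1 k) hδ' hρ0 hUBc hUBf hPc hPf hFED hONE hREG

end Tower

end Summit.QuantumFields.BalabanUV.T4Continuum.VariationalVectorEndOfLeaves

end
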